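import Summits.CriticalPhenomena.PercolationContinuityZ3.Theorems.Transplant.SkelPhiNegReachRoomsRead
import HarnessLib

/-!
# N1 (the `{±1}` node), (C) column file (C-S9a): READING CRITERIA — when the cell map's resolutions are COMMENSURATE with the long lattice
# (`c_i'·A·40Δ = r_i·D`, `Δ = modulus n h v_α v_β`: one stride reads `r_i/40` fine units; this is the case of record `A = 800`, `c_i' = 20·r_i`,
# `D = 800²·Δ`), the four reading inequalities of a run box `[lo, hi]` of the frame `runX φ c₀ n h 1` reduce to integer inequalities WITHOUT divisions:
# `X ≤ rdLo₁ ⟸ 40Δ·X ≤ r₁·U·lo₁`, `rdHi₁ ≤ Y ⟸ r₁·(U·hi₁ + U − 1) < 40Δ·Y`, `X ≤ rdLo₀ ⟸ 40Δ·n·X + r₀·n ≤ r₀·(Δ·lo₀ − M⁺)`,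
# `rdHi₀ ≤ Y ⟸ r₀·(Δ·hi₀ − M⁻) < 40Δ·n·Y` (`M^± = max / min (v_α·U·lo₁, v_α·(U·hi₁ + U − 1))`, `U = n + |h|`); and the two packaged room
# lemmas every corridor segment uses: **`rooms_small`** (a box within `±X₀ × ±X₁` run units with `Δ·X₀ + |v_α|·U·(X₁+1) ≤ 76·Δ·n`,
# `U·(X₁+1) ≤ 77·Δ` reads inside `±(2r_i − 1)` on BOTH axes — hence inside every room of `reachOblRHN_negSG₂b`, either sign, with one unit of
# margin) and the one-sided along criteria **`along0_lo/hi`, `along1_lo/hi`** for the long band boxes.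

builds on p205010 (kernel theorem, internal audit signed; external expert review pending) — nothing in this file uses p205010; nothing here is a
claim about the open node `SamePDropOfSkeletonNeg`.
Lane `prim-bschramm`, seat `prim-bschramm-p5` (gen 9; (C) lineage); helper file (`--supports stmt-CriticalPhenomena-4575`).
[cite: KozmaNitzan2024, §4 Lemma 12 (pp. 23–25), p. 26 (Q_v, M_v, H_{v,x})] [cite: MartineauTassion2017, §4.1]
-/

noncomputable section

namespace Summit.CriticalPhenomena.PercolationContinuityZ3.Theorems

namespace Transplant

namespace Skelφ

open Literature.Probability.Percolation Literature.Probability.LatticeModels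
open Literature.Probability.Percolation.KozmaNitzan.Cells (oth oth_ne sgOf sgOf_sign eq_oth_of_ne)
open TwoAxis.Para (modulus)
open ChainPlanar ChainPara

section Criteria

variable {A : ℤ} {n : ℕ} {h vα vβ c₀' c₁' D : ℤ} {P : PCells2}
  (hn : 1 ≤ n) (hA : 0 < A) (hD : 0 < D) (hm : 0 < modulus n h vα vβ) (hc₀ : 0 < c₀') (hc₁ : 0 < c₁')
  (hsc0 : c₀' * A * (40 * modulus n h vα vβ) = (P.r 0 : ℤ) * D) (hsc1 : c₁' * A * (40 * modulus n h vα vβ) = (P.r 1 : ℤ) * D)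

/-! ## §1 The four reading criteria -/

/-- The axis-`1` lower reading unfolded. [folklore] -/
theorem rdLo_one (lo hi : Site 2) : rdLo A n h vα vβ c₀' c₁' D lo hi 1 = (c₁' * (A * ((shearUnit n h : ℤ) * lo 1))) / D := rfl

/-- The axis-`1` upper reading unfolded. [folklore] -/
theorem rdHi_one (lo hi : Site 2) : rdHi A n h vα vβ c₀' c₁' D lo hi 1 = (c₁' * (A * ((shearUnit n h : ℤ) * hi 1 + shearUnit n h - 1))) / D + 1 := rfl

/-- The axis-`0` lower reading unfolded. [folklore] -/
theorem rdLo_zero (lo hi : Site 2) : rdLo A n h vα vβ c₀' c₁' D lo hi 0 =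
    (c₀' * (A * (modulus n h vα vβ * lo 0 - max (vα * ((shearUnit n h : ℤ) * lo 1)) (vα * ((shearUnit n h : ℤ) * hi 1 + shearUnit n h - 1))) / n)) / D := rfl

/-- The axis-`0` upper reading unfolded. [folklore] -/
theorem rdHi_zero (lo hi : Site 2) : rdHi A n h vα vβ c₀' c₁' D lo hi 0 =
    (c₀' * (A * (modulus n h vα vβ * hi 0 - min (vα * ((shearUnit n h : ℤ) * lo 1)) (vα * ((shearUnit n h : ℤ) * hi 1 + shearUnit n h - 1))) / n)) / D
      + 1 := rfl

include hD hm hsc1 in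
/-- **Axis-`1` lower criterion**: `40Δ·X ≤ r₁·U·lo₁ ⟹ X ≤ rdLo₁`. [this work] -/
theorem rdLo_one_ge {lo hi : Site 2} {X : ℤ} (hX : 40 * modulus n h vα vβ * X ≤ (P.r 1 : ℤ) * ((shearUnit n h : ℤ) * lo 1)) :
    X ≤ rdLo A n h vα vβ c₀' c₁' D lo hi 1 := by
  rw [rdLo_one, Int.le_ediv_iff_mul_le hD]
  have h40 : (0 : ℤ) < 40 * modulus n h vα vβ := by positivity
  refine le_of_mul_le_mul_right ?_ h40
  have e : c₁' * (A * ((shearUnit n h : ℤ) * lo 1)) * (40 * modulus n h vα vβ) = (P.r 1 : ℤ) * ((shearUnit n h : ℤ) * lo 1) * D := by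
    linear_combination ((shearUnit n h : ℤ) * lo 1) * hsc1
  rw [e]
  have := mul_le_mul_of_nonneg_right hX hD.le
  linarith

include hD hm hsc1 in
/-- **Axis-`1` upper criterion**: `r₁·(U·hi₁ + U − 1) < 40Δ·Y ⟹ rdHi₁ ≤ Y`. [this work] -/
theorem rdHi_one_le {lo hi : Site 2} {Y : ℤ} (hY : (P.r 1 : ℤ) * ((shearUnit n h : ℤ) * hi 1 + shearUnit n h - 1) < 40 * modulus n h vα vβ * Y) :
    rdHi A n h vα vβ c₀' c₁' D lo hi 1 ≤ Y := by
  rw [rdHi_one]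
  suffices hlt : (c₁' * (A * ((shearUnit n h : ℤ) * hi 1 + shearUnit n h - 1))) / D < Y by omega
  rw [Int.ediv_lt_iff_lt_mul hD]
  have h40 : (0 : ℤ) < 40 * modulus n h vα vβ := by positivity
  refine lt_of_mul_lt_mul_right ?_ h40.le
  have e : c₁' * (A * ((shearUnit n h : ℤ) * hi 1 + shearUnit n h - 1)) * (40 * modulus n h vα vβ) =
      (P.r 1 : ℤ) * ((shearUnit n h : ℤ) * hi 1 + shearUnit n h - 1) * D := by
    linear_combination ((shearUnit n h : ℤ) * hi 1 + shearUnit n h - 1) * hsc1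
  rw [e]
  have := mul_lt_mul_of_pos_right hY hD
  linarith

include hn hA hD hm hc₀ hsc0 in
/-- **Axis-`0` lower criterion**: `40Δ·n·X + r₀·n ≤ r₀·(Δ·lo₀ − M⁺) ⟹ X ≤ rdLo₀` (the inner floor `⌊·/n⌋` costs at most `r₀·n/A ≤ r₀·n`). [this work] -/
theorem rdLo_zero_ge {lo hi : Site 2} {X : ℤ}
    (hX : 40 * modulus n h vα vβ * (n * X) + (P.r 0 : ℤ) * n ≤
      (P.r 0 : ℤ) * (modulus n h vα vβ * lo 0 - max (vα * ((shearUnit n h : ℤ) * lo 1)) (vα * ((shearUnit n h : ℤ) * hi 1 + shearUnit n h - 1)))) :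
    X ≤ rdLo A n h vα vβ c₀' c₁' D lo hi 0 := by
  rw [rdLo_zero, Int.le_ediv_iff_mul_le hD]
  set Z := modulus n h vα vβ * lo 0 - max (vα * ((shearUnit n h : ℤ) * lo 1)) (vα * ((shearUnit n h : ℤ) * hi 1 + shearUnit n h - 1)) with hZ
  have hn0 : (0 : ℤ) < n := by exact_mod_cast hn
  have h40 : (0 : ℤ) < 40 * modulus n h vα vβ := by positivity
  have hr : (0 : ℤ) ≤ P.r 0 := by positivity
  -- the inner floor: `n·⌊A Z/n⌋ ≥ A Z − n + 1`
  have hfl : A * Z - n + 1 ≤ (n : ℤ) * (A * Z / n) := by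
    have := Int.lt_mul_ediv_self_add (x := A * Z) hn0; linarith
  -- `40Δ·c₀' ≤ r₀·D` (from `c₀'·A·40Δ = r₀·D`, `1 ≤ A`)
  have hcD : c₀' * (40 * modulus n h vα vβ) ≤ (P.r 0 : ℤ) * D := by
    have h1 : c₀' * (40 * modulus n h vα vβ) * 1 ≤ c₀' * (40 * modulus n h vα vβ) * A :=
      mul_le_mul_of_nonneg_left (by omega) (by positivity)
    have e : c₀' * (40 * modulus n h vα vβ) * A = (P.r 0 : ℤ) * D := by linear_combination hsc0
    linarith
  refine le_of_mul_le_mul_left ?_ hn0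
  refine le_of_mul_le_mul_right ?_ h40
  have key : (n : ℤ) * (X * D) * (40 * modulus n h vα vβ) ≤ (c₀' * (40 * modulus n h vα vβ)) * ((n : ℤ) * (A * Z / n)) :=
    calc (n : ℤ) * (X * D) * (40 * modulus n h vα vβ) = D * (40 * modulus n h vα vβ * (n * X)) := by ring
      _ ≤ D * ((P.r 0 : ℤ) * Z - (P.r 0 : ℤ) * n) := mul_le_mul_of_nonneg_left (by linarith) hD.le
      _ = (P.r 0 : ℤ) * D * Z - (P.r 0 : ℤ) * D * n := by ring
      _ ≤ (P.r 0 : ℤ) * D * Z - c₀' * (40 * modulus n h vα vβ) * n := by nlinarith [mul_le_mul_of_nonneg_right hcD hn0.le]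
      _ ≤ (P.r 0 : ℤ) * D * Z - c₀' * (40 * modulus n h vα vβ) * (n - 1) := by nlinarith [mul_pos hc₀ h40]
      _ = (c₀' * (40 * modulus n h vα vβ)) * (A * Z - n + 1) := by
          have e : c₀' * (40 * modulus n h vα vβ) * A = (P.r 0 : ℤ) * D := by linear_combination hsc0
          linear_combination (-Z) * e
      _ ≤ (c₀' * (40 * modulus n h vα vβ)) * ((n : ℤ) * (A * Z / n)) := mul_le_mul_of_nonneg_left hfl (by positivity)
  calc (n : ℤ) * (X * D) * (40 * modulus n h vα vβ) ≤ (c₀' * (40 * modulus n h vα vβ)) * ((n : ℤ) * (A * Z / n)) := key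
    _ = (n : ℤ) * (c₀' * (A * Z / n)) * (40 * modulus n h vα vβ) := by ring

include hn hD hm hc₀ hsc0 in
/-- **Axis-`0` upper criterion**: `r₀·(Δ·hi₀ − M⁻) < 40Δ·n·Y ⟹ rdHi₀ ≤ Y`. [this work] -/
theorem rdHi_zero_le {lo hi : Site 2} {Y : ℤ}
    (hY : (P.r 0 : ℤ) * (modulus n h vα vβ * hi 0 - min (vα * ((shearUnit n h : ℤ) * lo 1)) (vα * ((shearUnit n h : ℤ) * hi 1 + shearUnit n h - 1))) <
      40 * modulus n h vα vβ * (n * Y)) :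
    rdHi A n h vα vβ c₀' c₁' D lo hi 0 ≤ Y := by
  rw [rdHi_zero]
  set Z := modulus n h vα vβ * hi 0 - min (vα * ((shearUnit n h : ℤ) * lo 1)) (vα * ((shearUnit n h : ℤ) * hi 1 + shearUnit n h - 1)) with hZ
  suffices hlt : (c₀' * (A * Z / n)) / D < Y by omega
  rw [Int.ediv_lt_iff_lt_mul hD]
  have hn0 : (0 : ℤ) < n := by exact_mod_cast hn
  have h40 : (0 : ℤ) < 40 * modulus n h vα vβ := by positivity
  have hfl : (n : ℤ) * (A * Z / n) ≤ A * Z := Int.mul_ediv_self_le hn0.ne'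
  refine lt_of_mul_lt_mul_left (a := (n : ℤ)) ?_ hn0.le
  refine lt_of_mul_lt_mul_right ?_ h40.le
  have e : c₀' * (40 * modulus n h vα vβ) * A = (P.r 0 : ℤ) * D := by linear_combination hsc0
  calc (n : ℤ) * (c₀' * (A * Z / n)) * (40 * modulus n h vα vβ) = (c₀' * (40 * modulus n h vα vβ)) * ((n : ℤ) * (A * Z / n)) := by ring
    _ ≤ (c₀' * (40 * modulus n h vα vβ)) * (A * Z) := mul_le_mul_of_nonneg_left hfl (by positivity)
    _ = D * ((P.r 0 : ℤ) * Z) := by linear_combination Z * e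
    _ < D * (40 * modulus n h vα vβ * (n * Y)) := mul_lt_mul_of_pos_left hY hD
    _ = (n : ℤ) * (Y * D) * (40 * modulus n h vα vβ) := by ring

/-! ## §2 Small boxes read inside `±(2r − 1)` on both axes -/

include hn hm in
/-- The mixed term of the axis-`0` readings is bounded by `|v_α|·U·(X₁ + 1)` on a box within `±X₁` across. [folklore] -/
theorem mixed_le {z : ℤ} {X₁ : ℤ} (hz : |z| ≤ X₁) :
    |vα * ((shearUnit n h : ℤ) * z)| ≤ |vα| * ((shearUnit n h : ℤ) * (X₁ + 1)) ∧
      |vα * ((shearUnit n h : ℤ) * z + shearUnit n h - 1)| ≤ |vα| * ((shearUnit n h : ℤ) * (X₁ + 1)) := by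
  have _hm := hm
  have hU : (0 : ℤ) ≤ shearUnit n h := by positivity
  have hU1 : (1 : ℤ) ≤ shearUnit n h := by
    have : 1 ≤ shearUnit n h := by unfold shearUnit; omega
    exact_mod_cast this
  have hv0 : (0 : ℤ) ≤ |vα| := abs_nonneg _
  have hz0 : 0 ≤ X₁ := (abs_nonneg z).trans hz
  have hUz : (shearUnit n h : ℤ) * |z| ≤ (shearUnit n h : ℤ) * X₁ := mul_le_mul_of_nonneg_left hz hU
  constructor
  · rw [abs_mul, abs_mul, abs_of_nonneg hU]
    exact mul_le_mul_of_nonneg_left (by nlinarith) hv0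
  · rw [abs_mul]
    refine mul_le_mul_of_nonneg_left (abs_le.2 ⟨?_, ?_⟩) hv0
    · have := (abs_le.1 (show |(shearUnit n h : ℤ) * z| ≤ (shearUnit n h : ℤ) * X₁ by rwa [abs_mul, abs_of_nonneg hU])).1
      nlinarith
    · have := (abs_le.1 (show |(shearUnit n h : ℤ) * z| ≤ (shearUnit n h : ℤ) * X₁ by rwa [abs_mul, abs_of_nonneg hU])).2
      nlinarith

include hn hA hD hm hc₀ hsc0 hsc1 in
/-- **A small run box reads inside `±(2r_i − 1)` on both axes**: if `lo₀ ≥ −X₀`, `hi₀ ≤ X₀`, `|lo₁|, |hi₁| ≤ X₁` with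
`Δ·X₀ + |v_α|·U·(X₁ + 1) ≤ 76·Δ·n` and `U·(X₁ + 1) ≤ 77·Δ`, then `−(2r_i) + 1 ≤ rdLo_i` and `rdHi_i ≤ 2r_i − 1` for `i = 0, 1` (`r_i ≥ 20`).
[this work] -/
theorem rooms_small {lo hi : Site 2} {X₀ X₁ : ℤ} (h0l : -X₀ ≤ lo 0) (h0h : hi 0 ≤ X₀) (h1l : |lo 1| ≤ X₁) (h1h : |hi 1| ≤ X₁)
    (hS₀ : modulus n h vα vβ * X₀ + |vα| * ((shearUnit n h : ℤ) * (X₁ + 1)) ≤ 76 * modulus n h vα vβ * n)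
    (hS₁ : (shearUnit n h : ℤ) * (X₁ + 1) ≤ 77 * modulus n h vα vβ) (i : Fin 2) :
    -(2 * (P.r i : ℤ)) + 1 ≤ rdLo A n h vα vβ c₀' c₁' D lo hi i ∧ rdHi A n h vα vβ c₀' c₁' D lo hi i ≤ 2 * (P.r i : ℤ) - 1 := by
  have hr0 : (20 : ℤ) ≤ P.r 0 := by have := P.twenty_mul_s_le_r 0; have := P.hs 0; omega
  have hr1 : (20 : ℤ) ≤ P.r 1 := by have := P.twenty_mul_s_le_r 1; have := P.hs 1; omega
  have hΔ : (0 : ℤ) < modulus n h vα vβ := hm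
  have hΔ1 : (1 : ℤ) ≤ modulus n h vα vβ := hm
  have hU : (0 : ℤ) ≤ shearUnit n h := by positivity
  have hn1 : (1 : ℤ) ≤ n := by exact_mod_cast hn
  have hX₁ : 0 ≤ X₁ := (abs_nonneg _).trans h1l
  set C := |vα| * ((shearUnit n h : ℤ) * (X₁ + 1)) with hC
  have hC0 : 0 ≤ C := by positivity
  have hmax : max (vα * ((shearUnit n h : ℤ) * lo 1)) (vα * ((shearUnit n h : ℤ) * hi 1 + shearUnit n h - 1)) ≤ C :=
    max_le ((le_abs_self _).trans (mixed_le hn hm h1l).1) ((le_abs_self _).trans (mixed_le hn hm h1h).2)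
  have hmin : -C ≤ min (vα * ((shearUnit n h : ℤ) * lo 1)) (vα * ((shearUnit n h : ℤ) * hi 1 + shearUnit n h - 1)) :=
    le_min ((neg_le_neg (mixed_le hn hm h1l).1).trans (neg_abs_le _)) ((neg_le_neg (mixed_le hn hm h1h).2).trans (neg_abs_le _))
  fin_cases i
  · -- axis 0
    constructor
    · refine rdLo_zero_ge hn hA hD hm hc₀ hsc0 ?_
      show 40 * modulus n h vα vβ * (n * (-(2 * (P.r 0 : ℤ)) + 1)) + (P.r 0 : ℤ) * n ≤ _
      have h1 : (P.r 0 : ℤ) * (modulus n h vα vβ * (-X₀) - C) ≤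
          (P.r 0 : ℤ) * (modulus n h vα vβ * lo 0 - max (vα * ((shearUnit n h : ℤ) * lo 1)) (vα * ((shearUnit n h : ℤ) * hi 1 + shearUnit n h - 1))) :=
        mul_le_mul_of_nonneg_left (by have := mul_le_mul_of_nonneg_left h0l hΔ.le; linarith) (by linarith)
      have h2 : (P.r 0 : ℤ) * (modulus n h vα vβ * X₀ + C) ≤ (P.r 0 : ℤ) * (76 * modulus n h vα vβ * n) := mul_le_mul_of_nonneg_left hS₀ (by linarith)
      have h3 : 40 * modulus n h vα vβ * n ≤ 2 * modulus n h vα vβ * n * (P.r 0 : ℤ) := by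
        have := mul_le_mul_of_nonneg_left hr0 (show (0:ℤ) ≤ modulus n h vα vβ * n by positivity); linarith
      have h4 : (P.r 0 : ℤ) * n ≤ modulus n h vα vβ * n * (P.r 0 : ℤ) := by
        have := mul_le_mul_of_nonneg_left hΔ1 (show (0:ℤ) ≤ n * (P.r 0 : ℤ) by positivity); linarith
      have h5 : (0 : ℤ) ≤ modulus n h vα vβ * n * (P.r 0 : ℤ) := by positivity
      linarith
    · refine rdHi_zero_le hn hD hm hc₀ hsc0 ?_
      show (P.r 0 : ℤ) * _ < 40 * modulus n h vα vβ * (n * (2 * (P.r 0 : ℤ) - 1))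
      have h1 : (P.r 0 : ℤ) * (modulus n h vα vβ * hi 0 - min (vα * ((shearUnit n h : ℤ) * lo 1)) (vα * ((shearUnit n h : ℤ) * hi 1 + shearUnit n h - 1))) ≤
          (P.r 0 : ℤ) * (modulus n h vα vβ * X₀ + C) :=
        mul_le_mul_of_nonneg_left (by have := mul_le_mul_of_nonneg_left h0h hΔ.le; linarith) (by linarith)
      have h2 : (P.r 0 : ℤ) * (modulus n h vα vβ * X₀ + C) ≤ (P.r 0 : ℤ) * (76 * modulus n h vα vβ * n) := mul_le_mul_of_nonneg_left hS₀ (by linarith)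
      have h3 : 40 * modulus n h vα vβ * n < 4 * modulus n h vα vβ * n * (P.r 0 : ℤ) := by
        have := mul_le_mul_of_nonneg_left hr0 (show (0:ℤ) ≤ modulus n h vα vβ * n by positivity)
        have : 0 < modulus n h vα vβ * n := by positivity
        linarith
      have h5 : (0 : ℤ) ≤ modulus n h vα vβ * n * (P.r 0 : ℤ) := by positivity
      linarith
  · -- axis 1
    have hl1 := (abs_le.1 h1l).1
    have hh1 := (abs_le.1 h1h).2
    constructor
    · refine rdLo_one_ge hD hm hsc1 ?_
      show 40 * modulus n h vα vβ * (-(2 * (P.r 1 : ℤ)) + 1) ≤ (P.r 1 : ℤ) * ((shearUnit n h : ℤ) * lo 1)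
      have h1 : (P.r 1 : ℤ) * ((shearUnit n h : ℤ) * (-X₁)) ≤ (P.r 1 : ℤ) * ((shearUnit n h : ℤ) * lo 1) :=
        mul_le_mul_of_nonneg_left (mul_le_mul_of_nonneg_left hl1 hU) (by linarith)
      have h2 : (P.r 1 : ℤ) * ((shearUnit n h : ℤ) * (X₁ + 1)) ≤ (P.r 1 : ℤ) * (77 * modulus n h vα vβ) := mul_le_mul_of_nonneg_left hS₁ (by linarith)
      have h3 : 40 * modulus n h vα vβ ≤ 2 * modulus n h vα vβ * (P.r 1 : ℤ) := by
        have := mul_le_mul_of_nonneg_left hr1 hΔ.le; linarith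
      have h4 : (0 : ℤ) ≤ (P.r 1 : ℤ) * (shearUnit n h : ℤ) := by positivity
      have h5 : (0 : ℤ) ≤ modulus n h vα vβ * (P.r 1 : ℤ) := by positivity
      linarith
    · refine rdHi_one_le hD hm hsc1 ?_
      show (P.r 1 : ℤ) * ((shearUnit n h : ℤ) * hi 1 + shearUnit n h - 1) < 40 * modulus n h vα vβ * (2 * (P.r 1 : ℤ) - 1)
      have h1 : (P.r 1 : ℤ) * ((shearUnit n h : ℤ) * hi 1 + shearUnit n h - 1) ≤ (P.r 1 : ℤ) * ((shearUnit n h : ℤ) * (X₁ + 1) - 1) :=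
        mul_le_mul_of_nonneg_left (by have := mul_le_mul_of_nonneg_left hh1 hU; linarith) (by linarith)
      have h2 : (P.r 1 : ℤ) * ((shearUnit n h : ℤ) * (X₁ + 1)) ≤ (P.r 1 : ℤ) * (77 * modulus n h vα vβ) := mul_le_mul_of_nonneg_left hS₁ (by linarith)
      have h3 : 40 * modulus n h vα vβ < 3 * modulus n h vα vβ * (P.r 1 : ℤ) := by
        have := mul_le_mul_of_nonneg_left hr1 hΔ.le; linarith
      have h4 : (0 : ℤ) ≤ (P.r 1 : ℤ) := by linarith
      have h5 : (0 : ℤ) ≤ modulus n h vα vβ * (P.r 1 : ℤ) := by positivity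
      linarith

end Criteria

end Skelφ

end Transplant

end Summit.CriticalPhenomena.PercolationContinuityZ3.Theorems

end
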